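/-
Copyright: width seat `ym-line-sll-p2` (prover-ym-line-sll-p2-g2-0), route `SoftLoopLongLag`, crux T′ `ColdBoxSoftLoopLagFloor`
(stmt-QuantumFields-24180), line `birth`, registered stub E1a `stub_innerFlatLagFloorG`, brick 4.
-/
import Summits.QuantumFields.YangMills.Theorems.SoftLoopLongLagInnerFlatLoopStokes
import Summits.QuantumFields.YangMills.Theorems.SoftLoopLongLagLoopCostCubic
import Summits.QuantumFields.YangMills.Theorems.ColdBoxAllGroupsBoxFloorAllGroupsTiltBoundG

/-!
# Route `SoftLoopLongLag`, crux T′, stub E1a, brick E1a-4 «LoopChart»: the `R×R` Wilson LOOP of the chart configuration of the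
# one-scale engine — the holonomy as a product of `4R` small exponentials, and on the link ball the loop cost is the quadratic loop
# surrogate up to `9β(4Rm)³` (every compact group presented in `U(N)`)

The sibling engine (`ColdBoxAllGroupsOneScaleDefs`) reads the cold-wall box through the chart configuration `cfgTE ρ H β t` (links
`expChart ρ (a_e)`, `a = extZero (unscaleTE H D β t)`, `D = dimE ρ`).  For the soft-loop observable of this route we need, per `R×R` square
`w = rectWalk y 1 2 R R` and on the link ball `‖a_e‖ ≤ m`:

* `rho_walkHolonomy_expChart` — `ρ(hol_w) = Π_{darts} e^{lieIso ρ (±a_e)}` (a list product of `4R` exponentials, signed by orientation;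
  `ρ(expChart ρ a) = e^{lieIso ρ a}`, `ρ((expChart ρ a)⁻¹) = e^{−lieIso ρ a}`);
* `norm_sq_dartSum_eq` — the squared norm of the linear term `Σ_{darts} ±a_e ∈ ℝ^D` is `β⁻¹ Σ_i (Σ_{p ∈ rectSurface y R R} dirCirc H p (t_i))²`
  (colour by colour the circulation of `a_i = dirGlue H (t_i)/√β`, lattice Stokes `circ_rectWalk_eq_sum_rectSurface`, and
  `sCirc_extZero_unscaleTE`);
* **`abs_beta_mul_loopCost_sub_loopQ_le`** — with `Q_y(t) = Σ_i (Σ_{p∈rectSurface y R R} dirCirc H p (t_i))²` and `4R·m ≤ 1/4`: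
  `|β·(N − Re tr ρ(hol_w(cfgTE t))) − Q_y(t)/2| ≤ 9β(4Rm)³` (the tree's `abs_cost_expChart_listProd_sub_half_norm_sq_le`), together with
  `0 ≤ cost` (unitarity) and `Q_y(t) ≤ β(4Rm)²`, hence `0 ≤ β·cost ≤ β((4Rm)²/2 + 9(4Rm)³)` (`loopCost_nonneg`, `loopQ_le_on_ball`,
  `beta_mul_loopCost_le`).
No sorry; no new definition; standard axioms.  HONEST LABEL: rung R2xi-G RECORD label (leaf `WeakCouplingRates.XiPow`, an UPPER bound on the
lattice mass gap); NOT the Clay mass gap; no summit statement is touched.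

References: K. Wilson, Phys. Rev. D 10 (1974) §III; T. Bałaban, CMP 98 (1985) §1 (small-field expansion of Wilson loops in the axial gauge).
-/

set_option autoImplicit false

noncomputable section

open scoped Matrix Matrix.Norms.Frobenius
open NormedSpace Finset
open Literature.Probability.LatticeModels (Site zdGraph)
open Literature.MathematicalPhysics.QuantumLattice
open Literature.MathematicalPhysics.QuantumFieldTheory.LatticeMaxwell
open Literature.MathematicalPhysics.QuantumFieldTheory.AxialGauge
open Summit.QuantumFields.YangMills.Theorems.WeakCouplingRates
open Summit.QuantumFields.YangMills.Theorems.FreeEnergyLogCoefficient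
open Summit.QuantumFields.YangMills.Theorems.ColdBoxAllGroups (cfgTE unscaleTE TSpaceD norm_extZero_le rho_expChart_inv
  sCirc_extZero_unscaleTE)

namespace Summit.QuantumFields.YangMills.Theorems.SoftLoopLongLag

variable {N : ℕ} {G : Type*} [Group G] (ρ : G →* Matrix (Fin N) (Fin N) ℂ) {H : ℕ}

/-! ## Coordinates of list sums in `ℝ^D` -/

/-- Coordinates of a list sum of vectors of `ℝ^D`. -/
theorem list_sum_apply {D : ℕ} (l : List (EuclideanSpace ℝ (Fin D))) (i : Fin D) :
    l.sum i = (l.map fun v => v i).sum := by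
  induction l with
  | nil => simp
  | cons v l ih => simp [ih]

/-- Coordinates of a signed vector. -/
theorem ite_neg_apply {D : ℕ} (b : Bool) (v : EuclideanSpace ℝ (Fin D)) (i : Fin D) :
    (if b then v else -v) i = if b then v i else -(v i) := by
  cases b <;> simp

/-- `‖Σ_k v_k‖ ≤ Σ_k ‖v_k‖` for a list of vectors. -/
theorem norm_list_sum_le_sum_norm {E : Type*} [SeminormedAddCommGroup E] (l : List E) : ‖l.sum‖ ≤ (l.map (‖·‖)).sum := by
  induction l with
  | nil => simp
  | cons v l ih =>
    simp only [List.sum_cons, List.map_cons]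
    exact (norm_add_le _ _).trans (by gcongr)

/-! ## The chart holonomy of a walk as a product of exponentials -/

section Chart

variable [TopologicalSpace G] [CompactSpace G]

/-- One dart: `ρ(U_e^{±1}) = e^{lieIso ρ (±a_e)}` for the configuration `U = expChart ρ ∘ a`. -/
theorem rho_dartHolonomy_expChart (hρ : Continuous ρ) (a : Literature.MathematicalPhysics.QuantumLattice.ZdEdge 4 → EuclideanSpace ℝ (Fin (dimE ρ))) (e : (zdGraph 4).Dart) :
    ρ (dartHolonomy (fun e' => expChart ρ (a e')) e) =
      exp (lieIso ρ (if (dartStep e).2 then a (dartStep e).1 else -a (dartStep e).1)) := by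
  unfold dartHolonomy
  cases (dartStep e).2
  · simp only [Bool.false_eq_true, ↓reduceIte, map_neg]
    exact rho_expChart_inv ρ hρ _
  · simp only [↓reduceIte]
    exact rho_expChart ρ hρ _

/-- **The chart holonomy of a walk is a product of small exponentials**: `ρ(hol_w(expChart ρ ∘ a)) = Π_{darts d of w} e^{lieIso ρ (±a_d)}`. -/
theorem rho_walkHolonomy_expChart (hρ : Continuous ρ) (a : Literature.MathematicalPhysics.QuantumLattice.ZdEdge 4 → EuclideanSpace ℝ (Fin (dimE ρ))) {x y : Site 4}
    (w : (zdGraph 4).Walk x y) :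
    ρ (walkHolonomy (fun e' => expChart ρ (a e')) w) =
      ((w.darts.map fun e => if (dartStep e).2 then a (dartStep e).1 else -a (dartStep e).1).map fun v => exp (lieIso ρ v)).prod := by
  rw [walkHolonomy, MonoidHom.map_list_prod, List.map_map, List.map_map]
  congr 1
  exact List.map_congr_left fun e _ => rho_dartHolonomy_expChart ρ hρ a e

end Chart

/-! ## The linear term of the square loop is the loop flux -/

/-- **The squared norm of the signed dart sum of the chart coordinates around the `R×R` square is the quadratic loop surrogate / β**:
for `a = extZero (unscaleTE H D β t)` and `β > 0`,
`‖Σ_{darts} ±a‖² = β⁻¹ · Σ_i (Σ_{p ∈ rectSurface y R R} dirCirc H p (t_i))²`. -/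
theorem norm_sq_dartSum_eq {D : ℕ} {β : ℝ} (hβ : 0 < β) (t : TSpaceD H D) (y : Site 4) (R : ℕ) :
    ‖((rectWalk y 1 2 R R).darts.map fun e => if (dartStep e).2 then extZero (unscaleTE H D β t) (dartStep e).1
        else -extZero (unscaleTE H D β t) (dartStep e).1).sum‖ ^ 2 =
      (∑ i, (∑ p ∈ rectSurface y R R, dirCirc H (p.1, p.2.1.1, p.2.1.2) (t i)) ^ 2) / β := by
  rw [EuclideanSpace.real_norm_sq_eq, Finset.sum_div]
  refine Finset.sum_congr rfl fun i _ => ?_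
  rw [list_sum_apply, List.map_map]
  have hcoord : ((rectWalk y 1 2 R R).darts.map ((fun v : EuclideanSpace ℝ (Fin D) => v i) ∘ fun e =>
      if (dartStep e).2 then extZero (unscaleTE H D β t) (dartStep e).1 else -extZero (unscaleTE H D β t) (dartStep e).1)).sum =
      ∑ p ∈ rectSurface y R R, sCirc (fun e' => extZero (unscaleTE H D β t) e' i) (p.1, p.2.1.1, p.2.1.2) := by
    rw [← circ_rectWalk_eq_sum_rectSurface]
    congr 1
    exact List.map_congr_left fun e _ => by simp only [Function.comp_apply, ite_neg_apply]
  rw [hcoord]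
  simp only [sCirc_extZero_unscaleTE]
  rw [← Finset.sum_div, div_pow, Real.sq_sqrt hβ.le]

/-! ## The loop cost on the link ball -/

section Cost

variable [TopologicalSpace G] [CompactSpace G]

omit [TopologicalSpace G] [CompactSpace G] in
/-- The chart configuration, unfolded. -/
theorem cfgTE_eq_expChart_extZero (β : ℝ) (t : TSpaceD H (dimE ρ)) :
    cfgTE ρ H β t = fun e => expChart ρ (extZero (unscaleTE H (dimE ρ) β t) e) := rfl

omit [TopologicalSpace G] [CompactSpace G] in
/-- The perimeter sum of the norms of the signed chart coordinates around the `R×R` square is `≤ 4R·m` on the link ball. -/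
theorem dartSum_norm_le {β m : ℝ} (hm0 : 0 ≤ m) (t : TSpaceD H (dimE ρ)) (ht : ∀ e, ‖unscaleTE H (dimE ρ) β t e‖ ≤ m)
    (y : Site 4) (R : ℕ) :
    (((rectWalk y 1 2 R R).darts.map fun e => if (dartStep e).2 then extZero (unscaleTE H (dimE ρ) β t) (dartStep e).1
        else -extZero (unscaleTE H (dimE ρ) β t) (dartStep e).1).map (‖·‖)).sum ≤ 4 * R * m := by
  have h := sum_map_norm_signed_le (extZero (unscaleTE H (dimE ρ) β t)) (norm_extZero_le hm0 ht) (rectWalk y 1 2 R R)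
  rw [length_darts_rectWalk] at h
  refine h.trans (le_of_eq ?_)
  push_cast
  ring

/-- **The loop cost of the chart configuration is the quadratic loop surrogate up to a cubic remainder.**  For a continuous unitary-valued
`ρ`, `β > 0`, a colour tuple `t` on the link ball `‖unscaleTE t e‖ ≤ m` (`0 ≤ m`) and a square side `R` with `4R·m ≤ 1/4`:
`|β·(N − Re tr ρ(hol_{rectWalk y 1 2 R R}(cfgTE ρ H β t))) − ½ Σ_i (Σ_{p∈rectSurface y R R} dirCirc H p (t_i))²| ≤ 9·β·(4Rm)³`. -/
theorem abs_beta_mul_loopCost_sub_loopQ_le (hρ : Continuous ρ) {β m : ℝ} (hβ : 0 < β) (hm0 : 0 ≤ m) (t : TSpaceD H (dimE ρ))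
    (ht : ∀ e, ‖unscaleTE H (dimE ρ) β t e‖ ≤ m) (y : Site 4) (R : ℕ) (hRm : 4 * (R : ℝ) * m ≤ 1 / 4) :
    |β * ((N : ℝ) - (ρ (walkHolonomy (cfgTE ρ H β t) (rectWalk y 1 2 R R))).trace.re) -
        (∑ i, (∑ p ∈ rectSurface y R R, dirCirc H (p.1, p.2.1.1, p.2.1.2) (t i)) ^ 2) / 2| ≤
      9 * β * (4 * R * m) ^ 3 := by
  set l : List (EuclideanSpace ℝ (Fin (dimE ρ))) := (rectWalk y 1 2 R R).darts.map fun e =>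
    if (dartStep e).2 then extZero (unscaleTE H (dimE ρ) β t) (dartStep e).1
      else -extZero (unscaleTE H (dimE ρ) β t) (dartStep e).1 with hl
  have htm : (l.map (‖·‖)).sum ≤ 4 * R * m := dartSum_norm_le ρ hm0 t ht y R
  have ht0 : 0 ≤ (l.map (‖·‖)).sum := by
    refine List.sum_nonneg ?_
    intro v hv
    obtain ⟨u, -, rfl⟩ := List.mem_map.1 hv
    exact norm_nonneg _
  have hcub := abs_cost_expChart_listProd_sub_half_norm_sq_le ρ l (htm.trans hRm)
  rw [cfgTE_eq_expChart_extZero, rho_walkHolonomy_expChart ρ hρ, ← hl]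
  have hQ : ‖l.sum‖ ^ 2 / 2 = (∑ i, (∑ p ∈ rectSurface y R R, dirCirc H (p.1, p.2.1.1, p.2.1.2) (t i)) ^ 2) / β / 2 := by
    rw [hl, norm_sq_dartSum_eq hβ]
  rw [hQ] at hcub
  have e : β * ((N : ℝ) - ((l.map fun v => exp (lieIso ρ v)).prod).trace.re) -
      (∑ i, (∑ p ∈ rectSurface y R R, dirCirc H (p.1, p.2.1.1, p.2.1.2) (t i)) ^ 2) / 2 =
      β * (((N : ℝ) - ((l.map fun v => exp (lieIso ρ v)).prod).trace.re) -
        (∑ i, (∑ p ∈ rectSurface y R R, dirCirc H (p.1, p.2.1.1, p.2.1.2) (t i)) ^ 2) / β / 2) := by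
    field_simp
  rw [e, abs_mul, abs_of_pos hβ]
  calc β * |((N : ℝ) - ((l.map fun v => exp (lieIso ρ v)).prod).trace.re) -
        (∑ i, (∑ p ∈ rectSurface y R R, dirCirc H (p.1, p.2.1.1, p.2.1.2) (t i)) ^ 2) / β / 2|
      ≤ β * (9 * (l.map (‖·‖)).sum ^ 3) := mul_le_mul_of_nonneg_left hcub hβ.le
    _ ≤ β * (9 * (4 * R * m) ^ 3) := by gcongr
    _ = 9 * β * (4 * R * m) ^ 3 := by ring

omit [TopologicalSpace G] [CompactSpace G] in
/-- **The quadratic loop surrogate is small on the link ball**: `Σ_i (Σ_{p∈rectSurface y R R} dirCirc H p (t_i))² ≤ β·(4Rm)²`. -/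
theorem loopQ_le_on_ball {β m : ℝ} (hβ : 0 < β) (hm0 : 0 ≤ m) (t : TSpaceD H (dimE ρ))
    (ht : ∀ e, ‖unscaleTE H (dimE ρ) β t e‖ ≤ m) (y : Site 4) (R : ℕ) :
    ∑ i, (∑ p ∈ rectSurface y R R, dirCirc H (p.1, p.2.1.1, p.2.1.2) (t i)) ^ 2 ≤ β * (4 * R * m) ^ 2 := by
  set l : List (EuclideanSpace ℝ (Fin (dimE ρ))) := (rectWalk y 1 2 R R).darts.map fun e =>
    if (dartStep e).2 then extZero (unscaleTE H (dimE ρ) β t) (dartStep e).1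
      else -extZero (unscaleTE H (dimE ρ) β t) (dartStep e).1 with hl
  have htm : (l.map (‖·‖)).sum ≤ 4 * R * m := dartSum_norm_le ρ hm0 t ht y R
  have hnorm : ‖l.sum‖ ≤ 4 * R * m := (norm_list_sum_le_sum_norm l).trans htm
  have hsq : ‖l.sum‖ ^ 2 ≤ (4 * R * m) ^ 2 := pow_le_pow_left₀ (norm_nonneg _) hnorm 2
  rw [hl, norm_sq_dartSum_eq hβ, div_le_iff₀ hβ] at hsq
  linarith

omit [TopologicalSpace G] [CompactSpace G] in
/-- The loop cost is nonnegative (the holonomy is unitary): `0 ≤ N − Re tr ρ(hol)`. -/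
theorem loopCost_nonneg (hρu : ∀ g, ρ g ∈ Matrix.unitaryGroup (Fin N) ℂ) (U : LGConfig 4 G) {x : Site 4} (w : (zdGraph 4).Walk x x) :
    0 ≤ (N : ℝ) - (ρ (walkHolonomy U w)).trace.re := by
  rw [Literature.MathematicalPhysics.QuantumFieldTheory.sub_re_trace_eq_half_norm_sub_one_sq (hρu _)]
  positivity

/-- **Upper bound of the loop cost on the link ball**: `β·(N − Re tr ρ(hol)) ≤ β(4Rm)²/2 + 9β(4Rm)³`. -/
theorem beta_mul_loopCost_le (hρ : Continuous ρ) {β m : ℝ} (hβ : 0 < β) (hm0 : 0 ≤ m) (t : TSpaceD H (dimE ρ))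
    (ht : ∀ e, ‖unscaleTE H (dimE ρ) β t e‖ ≤ m) (y : Site 4) (R : ℕ) (hRm : 4 * (R : ℝ) * m ≤ 1 / 4) :
    β * ((N : ℝ) - (ρ (walkHolonomy (cfgTE ρ H β t) (rectWalk y 1 2 R R))).trace.re) ≤
      β * (4 * R * m) ^ 2 / 2 + 9 * β * (4 * R * m) ^ 3 := by
  have h1 := abs_beta_mul_loopCost_sub_loopQ_le ρ hρ hβ hm0 t ht y R hRm
  have h2 := loopQ_le_on_ball ρ hβ hm0 t ht y R
  have h3 := (abs_le.1 h1).2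
  linarith

end Cost

end Summit.QuantumFields.YangMills.Theorems.SoftLoopLongLag

end
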